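import Literature.MathematicalPhysics.QuantumLattice.DWaveSourceEnergyDensityEnsembles
import Literature.MathematicalPhysics.QuantumLattice.HubbardNNNHoppingEnergyDensityMonotone
import Literature.MathematicalPhysics.QuantumLattice.HubbardTTPrimeBoxTransport
import Literature.MathematicalPhysics.QuantumLattice.HubbardEnergyDensityChordBounds
import HarnessLib

/-!
# The ORDER-word budget has a floor BEFORE any sourced solve: window inhomogeneity
# (a vacuity guard for `R − μ₀·n − lo` numerators with a cell-wide cap `R`)

Topic `Literature/MathematicalPhysics/QuantumLattice` (family `hubbard`). Typed by cell `pub/hubbard-fast`, seat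
hubbard-fast-p1 g16 (planner; H-DIRECTION v1.4 §10.2 (B); pen sketch sha16 c553a00143a21def), landed verbatim by seat
hubbard-fast-lit g14. For the order words of `Downfold/TppSeamOrderFilling.lean` /
`TppSeamOrderCorners.lean` (hubbard-downfold-mod-1: `e_P(σ) ≤ (R − μ₀·n − min lo₁ lo₂ + ε)/h` from a cell-wide
canonical cap `R` and sourced floors `loᵢ ≤ e_src(sᵢ, U₀, μ₀, h)` at the lower-`U` corners): WHATEVER the
sourced floors, the chemical potential `μ₀` and the field `h`, the numerator at a member of filling `n` is at least
`R − e(1, s, U₁, n)` for every `U₁ ≥ U₀` — three tree facts: the source never raises the energy density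
(`dWaveSourceEnergyDensityTT'_le_at_zero`), the zero-field sourced density is a supporting line of the canonical
one (`dWaveSourceEnergyDensityTT'_zero_add_mul_le_energyDensityTT'`, Legendre), and `e` is non-decreasing in `U`
(`energyDensityTT'_mono_U`). With a certified canonical CAP `e(1, s, U₁, n) ≤ c` this is the explicit number
`R − c`: on the La-214 object-E box M15 (`R = −0.4130954130`, corner `s = −3/10`, `U₀ = 7.9 ≤ U₁ = 8`, member
filling `n = 7/8`, cap `c = −0.65652367198…` of EPS-CELL-TABLE v3.1c C050, exact rational) the numerator is
`≥ 0.2434282589`, so ABSENT(`< m₀`) can fire only for `h·m₀ > 0.2434282589` — `m₀ > 2.43 / 1.22 / 0.81` at `h = 0.1 / 0.2 / 0.3`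
against the saturation scale `2√2`: the as-typed word is vacuous by WINDOW INHOMOGENEITY, independently of solver
quality. (Cure: member-local caps — `DWaveOrderParameterUCells.lean`, `DWaveOrderParameterTPrimeCells.lean`.)

§2 moves a table cap onto a corner `t'` / member filling the table lacks (`abs_energyDensityTT'_sub_tPrime_le_decimal`,
`energyDensityTT'_le_density_chord`) and types the other two boxes: Na-CCOC object E M36 (`R = −0.3546462921`, member
`n = 22/25`, caps C050/C095 at `(−3/10, 8)`): `h·m₀ > 0.2959`; La-214 RE-BASED (downfold-lead 2026-08-27, lower edges
`U = 6.1` (E) / `5.3` (M)): object E `h·m₀ > 0.2495` (cap C049), object M `h·m₀ > R + 0.7448` (cap C075 moved by `3/100`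
in `t'`; the object-M window cap `R` is free).

Everything PROVED; no definition, no number certified (the table caps and the window caps `R` are hypotheses, quoted
as the EXACT rationals of EPS-CELL-TABLE v3.1c).
HONEST SCOPE: planning guard on the ceiling side; nothing here bears on superconductivity.

## References
* D. Ruelle, *Statistical Mechanics* (1969), §3.4 (equivalence of ensembles; Legendre). [cite: Ruelle1969, §3.4]
* T. Koma, H. Tasaki, Commun. Math. Phys. 158 (1994) 191, §1. [cite: KomaTasaki1994, §1]
-/

noncomputable section

namespace Literature.MathematicalPhysics.QuantumLattice

open ThermodynamicLimit

/-- **Budget floor from one corner.** `lo ≤ e_src(s, U₀, μ₀, h)`, `0 ≤ U₀ ≤ U₁`, `0 ≤ n < 2` ⇒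
`R − e(1,s,U₁,n) ≤ R − μ₀·n − lo` (any `R`, `μ₀`, `h`). [cite: Ruelle1969, §3.4] -/
theorem sub_energyDensityTT'_le_orderBudget {s U₀ U₁ μ₀ h lo n : ℝ} (hU₀ : 0 ≤ U₀) (hU : U₀ ≤ U₁)
    (hn0 : 0 ≤ n) (hn2 : n < 2) (hlo : lo ≤ dWaveSourceEnergyDensityTT' s U₀ μ₀ h) (R : ℝ) :
    R - energyDensityTT' 1 s U₁ n ≤ R - μ₀ * n - lo := by
  have h1 := dWaveSourceEnergyDensityTT'_le_at_zero s U₀ μ₀ h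
  have h2 := dWaveSourceEnergyDensityTT'_zero_add_mul_le_energyDensityTT' s hU₀ μ₀ hn0 hn2
  have h3 := energyDensityTT'_mono_U 1 s hn0 hn2 hU₀ hU
  linarith

/-- **With a certified cap** `e(1,s,U₁,n) ≤ c`: `R − c ≤ R − μ₀·n − lo`. [cite: Ruelle1969, §3.4] -/
theorem sub_cap_le_orderBudget {s U₀ U₁ μ₀ h lo n c : ℝ} (hU₀ : 0 ≤ U₀) (hU : U₀ ≤ U₁) (hn0 : 0 ≤ n)
    (hn2 : n < 2) (hlo : lo ≤ dWaveSourceEnergyDensityTT' s U₀ μ₀ h) (hc : energyDensityTT' 1 s U₁ n ≤ c) (R : ℝ) :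
    R - c ≤ R - μ₀ * n - lo := by
  have h := sub_energyDensityTT'_le_orderBudget hU₀ hU hn0 hn2 hlo R
  linarith

/-- **Two corners** (the `min lo₁ lo₂` shape of `TppSeamOrderCorners`): the budget floor from the first corner
survives the `min`. [cite: Ruelle1969, §3.4] -/
theorem sub_cap_le_orderBudget_min {s U₀ U₁ μ₀ h lo₁ lo₂ n c : ℝ} (hU₀ : 0 ≤ U₀) (hU : U₀ ≤ U₁) (hn0 : 0 ≤ n)
    (hn2 : n < 2) (hlo₁ : lo₁ ≤ dWaveSourceEnergyDensityTT' s U₀ μ₀ h) (hc : energyDensityTT' 1 s U₁ n ≤ c)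
    (R : ℝ) : R - c ≤ R - μ₀ * n - min lo₁ lo₂ := by
  have h := sub_cap_le_orderBudget hU₀ hU hn0 hn2 hlo₁ hc R
  have hmin := min_le_left lo₁ lo₂
  linarith

/-- **ABSENT needs `h·m₀ > R − c`**: if the as-typed budget inequality `h·m₀ > R − μ₀·n − min lo₁ lo₂` holds at a
member of filling `n`, then `h·m₀ > R − c`. [cite: KomaTasaki1994, §1] -/
theorem mul_gt_sub_cap_of_orderBudget {s U₀ U₁ μ₀ h lo₁ lo₂ n c R m₀ : ℝ} (hU₀ : 0 ≤ U₀) (hU : U₀ ≤ U₁)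
    (hn0 : 0 ≤ n) (hn2 : n < 2) (hlo₁ : lo₁ ≤ dWaveSourceEnergyDensityTT' s U₀ μ₀ h)
    (hc : energyDensityTT' 1 s U₁ n ≤ c) (hbudget : R - μ₀ * n - min lo₁ lo₂ < h * m₀) : R - c < h * m₀ :=
  (sub_cap_le_orderBudget_min hU₀ hU hn0 hn2 hlo₁ hc R).trans_lt hbudget

/-- **La-214 M15, object E, AS TYPED** (`boxLa214E_M15_pairAmplitude_le_lowerCorners_filling`: corner
`(−3/10, 79/10)`, window cap `R = −0.4130954130`; member filling `7/8 ∈ [0.855, 0.895]`): with the certified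
canonical cap of EPS-CELL-TABLE v3.1c, point C050, VERBATIM as the exact rational of record
`e(1, −3/10, 8, 7/8) ≤ −3968442091253295076562937/6044629098073145873530880 = −0.65652367198…` (source
`atlas:slopes['reg(8,-1/4,7/8)']`), every admissible `(μ₀, h, lo₁, lo₂)` for which the ABSENT(`< m₀`) budget fires
at filling `7/8` has `h·m₀ > 0.2434282589` (outward-rounded to 10 decimals).
[cite: KomaTasaki1994, §1] -/
theorem la214E_M15_orderBudget_floor {μ₀ h lo₁ lo₂ m₀ : ℝ}
    (hlo₁ : lo₁ ≤ dWaveSourceEnergyDensityTT' (-3/10) (79/10) μ₀ h)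
    (hc : energyDensityTT' 1 (-3/10) 8 (7/8) ≤ (((-3968442091253295076562937/6044629098073145873530880 : ℚ)) : ℝ))
    (hbudget : -0.4130954130 - μ₀ * (7/8) - min lo₁ lo₂ < h * m₀) : 0.2434282589 < h * m₀ := by
  have h := mul_gt_sub_cap_of_orderBudget (R := -0.4130954130) (by norm_num) (by norm_num) (by norm_num)
    (by norm_num) hlo₁ hc hbudget
  norm_num at h ⊢
  linarith

/-! ## Transported corner caps (no table point ON the corner `t'` or AT the member filling)

The guard needs a cap at `(s_corner, U₁, n_member)`; when the certified table has none there, two tree facts move a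
nearby cap onto it at a typed price: the class row `|e(s) − e(s')| ≤ 1.6212·|s − s'|`
(`abs_energyDensityTT'_sub_tPrime_le_decimal`, `16/π²` outward) and convexity in the filling
(`energyDensityTT'_le_density_chord`). -/

/-- **Corner cap from a neighbouring `t'`**: `e(1,s',U₁,n) ≤ c` ⇒ budget `≥ R − c − 1.6212·|s − s'|`.
[cite: Ruelle1969, §3.4] -/
theorem sub_cap_tPrime_le_orderBudget_min {s s' U₀ U₁ μ₀ h lo₁ lo₂ n c : ℝ} (hU₀ : 0 ≤ U₀) (hU : U₀ ≤ U₁)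
    (hn0 : 0 ≤ n) (hn2 : n < 2) (hlo₁ : lo₁ ≤ dWaveSourceEnergyDensityTT' s U₀ μ₀ h)
    (hc : energyDensityTT' 1 s' U₁ n ≤ c) (R : ℝ) :
    R - c - 1.6212 * |s - s'| ≤ R - μ₀ * n - min lo₁ lo₂ := by
  have h := sub_energyDensityTT'_le_orderBudget hU₀ hU hn0 hn2 hlo₁ R
  have hl := abs_energyDensityTT'_sub_tPrime_le_decimal 1 (hU₀.trans hU) hn0 hn2 s s'
  have hmin := min_le_left lo₁ lo₂
  have habs := (abs_sub_le_iff.1 hl).1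
  linarith

/-- **Corner cap at an off-table member filling** `n₁ < n < n₂` from the two table caps `e(nᵢ) ≤ uᵢ` at
`(s, U₁)`: budget `≥ R − ((n₂ − n)u₁ + (n − n₁)u₂)/(n₂ − n₁)`. [cite: Ruelle1969, §3.3] -/
theorem sub_chord_le_orderBudget_min {s U₀ U₁ μ₀ h lo₁ lo₂ n n₁ n₂ u₁ u₂ : ℝ} (hU₀ : 0 ≤ U₀) (hU : U₀ ≤ U₁)
    (hn₁ : 0 ≤ n₁) (h₁ : n₁ < n) (h₂ : n < n₂) (hn₂ : n₂ < 2)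
    (hlo₁ : lo₁ ≤ dWaveSourceEnergyDensityTT' s U₀ μ₀ h)
    (hu₁ : energyDensityTT' 1 s U₁ n₁ ≤ u₁) (hu₂ : energyDensityTT' 1 s U₁ n₂ ≤ u₂) (R : ℝ) :
    R - ((n₂ - n) * u₁ + (n - n₁) * u₂) / (n₂ - n₁) ≤ R - μ₀ * n - min lo₁ lo₂ := by
  have h := sub_energyDensityTT'_le_orderBudget hU₀ hU (hn₁.trans h₁.le) (h₂.trans hn₂) hlo₁ R
  have hch := energyDensityTT'_le_density_chord 1 s (hU₀.trans hU) hn₁ h₁ h₂ hn₂ hu₁ hu₂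
  have hmin := min_le_left lo₁ lo₂
  linarith

/-- **Na-CCOC M36, object E, AS TYPED** (`boxCCOCE_M36_pairAmplitude_le_lowerCorners_filling`: corners
`(−41/100, 71/10)` and `(−3/10, 71/10)`, window cap `R = −0.3546462921`, fillings `[0.88, 0.92]`): at the member of
filling `22/25` with the table caps C050 `e(1,−3/10,8,7/8)` and C095 `e(1,−3/10,8,1)` (EPS-CELL-TABLE v3.1c, exact
rationals) the ABSENT budget needs `h·m₀ > 0.2959` — above the saturation scale `2√2/10` already at `h = 1/10`.
[cite: KomaTasaki1994, §1] -/
theorem ccocE_M36_orderBudget_floor {μ₀ h lo₁ lo₂ m₀ : ℝ}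
    (hlo₂ : lo₂ ≤ dWaveSourceEnergyDensityTT' (-3/10) (71/10) μ₀ h)
    (hC050 : energyDensityTT' 1 (-3/10) 8 (7/8) ≤ (((-3968442091253295076562937/6044629098073145873530880 : ℚ)) : ℝ))
    (hC095 : energyDensityTT' 1 (-3/10) 8 1 ≤ (((-4475209735223/8796093022208 : ℚ)) : ℝ))
    (hbudget : -0.3546462921 - μ₀ * (22/25) - min lo₁ lo₂ < h * m₀) : 0.2959 < h * m₀ := by
  have h := sub_chord_le_orderBudget_min (R := -0.3546462921) (lo₁ := lo₂) (lo₂ := lo₁) (by norm_num) (by norm_num)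
    (by norm_num) (by norm_num : (7/8 : ℝ) < 22/25) (by norm_num : (22/25 : ℝ) < 1) (by norm_num) hlo₂ hC050 hC095
  rw [min_comm] at h
  norm_num at h ⊢
  linarith

/-- **La-214, object E, RE-BASED lower edge `U/t_eff = 6.1`** (downfold-lead 2026-08-27: box `[6.1, 14.7]`; corner
`(−3/10, 61/10)`, same window cap `R = −0.4130954130` or larger): with the table cap C049 `e(1,−3/10,7,7/8)` the
ABSENT budget at filling `7/8` needs `h·m₀ > 0.2495`. [cite: KomaTasaki1994, §1] -/
theorem la214E_rebased_orderBudget_floor {R μ₀ h lo₁ lo₂ m₀ : ℝ} (hR : -0.4130954130 ≤ R)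
    (hlo₁ : lo₁ ≤ dWaveSourceEnergyDensityTT' (-3/10) (61/10) μ₀ h)
    (hC049 : energyDensityTT' 1 (-3/10) 7 (7/8) ≤
      (((-35231018785338840859352094150481421885890901/53169119831396634916152282411213783040000000 : ℚ)) : ℝ))
    (hbudget : R - μ₀ * (7/8) - min lo₁ lo₂ < h * m₀) : 0.2495 < h * m₀ := by
  have h := mul_gt_sub_cap_of_orderBudget (R := R) (by norm_num) (by norm_num : (61/10 : ℝ) ≤ 7) (by norm_num)
    (by norm_num) hlo₁ hC049 hbudget
  norm_num at h ⊢
  linarith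

/-- **La-214, object M, RE-BASED lower edge `U/t = 5.3`** (corner `(−3/100, 53/10)`; the object-M window cap `R`
is not yet a number of record): with the table cap C075 `e(1,0,6,7/8) ≤ −0.7934466914` moved to `t' = −3/100` by the
class row, the ABSENT budget at filling `7/8` needs `h·m₀ > R + 0.7448`. [cite: KomaTasaki1994, §1] -/
theorem la214M_rebased_orderBudget_floor {R μ₀ h lo₁ lo₂ m₀ : ℝ}
    (hlo₂ : lo₂ ≤ dWaveSourceEnergyDensityTT' (-3/100) (53/10) μ₀ h)
    (hC075 : energyDensityTT' 1 0 6 (7/8) ≤ (((-3967233457/5000000000 : ℚ)) : ℝ))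
    (hbudget : R - μ₀ * (7/8) - min lo₁ lo₂ < h * m₀) : R + 0.7448 < h * m₀ := by
  have h := sub_cap_tPrime_le_orderBudget_min (R := R) (lo₁ := lo₂) (lo₂ := lo₁) (by norm_num)
    (by norm_num : (53/10 : ℝ) ≤ 6) (by norm_num) (by norm_num) hlo₂ hC075
  rw [min_comm] at h
  have habs : |(-3/100 : ℝ) - 0| = 3/100 := by norm_num [abs_of_neg]
  rw [habs] at h
  norm_num at h ⊢
  linarith

end Literature.MathematicalPhysics.QuantumLattice
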